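import Summits.RiemannHypothesis.RiemannHypothesis.Theses.SpectralTrace
import Summits.RiemannHypothesis.RiemannHypothesis.Theorems.WindowStep.Negative.Collapse
import Summits.RiemannHypothesis.RiemannHypothesis.Theorems.WindowStep.Negative.LoadBearing
import Summits.RiemannHypothesis.RiemannHypothesis.Theorems.SpectralTraceWindowTraceToPositivity
import Summits.RiemannHypothesis.RiemannHypothesis.Theorems.WeilWindowFlowGronwallLeakageStrictAnti
import Summits.RiemannHypothesis.RiemannHypothesis.Theorems.WindowTraceArch.Negative.LocalWeyl
import Summits.RiemannHypothesis.RiemannHypothesis.Theorems.SpectralTraceWindowStepStubTraceLimit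
import Summits.RiemannHypothesis.RiemannHypothesis.Theorems.SpectralTraceWindowStepStubTraceDilate
import Summits.RiemannHypothesis.RiemannHypothesis.Theorems.SpectralTraceWindowStepStubGroundStateSampling
import Summits.RiemannHypothesis.RiemannHypothesis.Theorems.SpectralTraceWindowStepCoagulationLittleO
import Literature.NumberTheory.LFunctions.WeilWindowSuzukiContinuityProofs
import Literature.NumberTheory.LFunctions.WeilGroundState
import Literature.NumberTheory.LFunctions.WeilGroundEnergyProofs
import Literature.NumberTheory.LFunctions.WeilSemilocalCompactnessProofs
import Literature.NumberTheory.LFunctions.WeilFirstPrimePositivityC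
import HarnessLib

/-!
# The conjugate-point dichotomy of the window ladder — route-level split glue for `WindowStep`

Crux `stmt-RiemannHypothesis-14659` (`SpectralTrace.WindowStep = ∀ n ≥ 2, Trace(log n) → Trace(log(n+1))`,
`Trace(A)`: some real unit-multiplicity family reproduces `W = weilFunctional` on the Weil tests
supported in `[-A, A]`). Line `conjugate-point` (`Cruxes/WindowStep/Lines/conjugate_point.lean`).

This file is the sorry-free GLUE of the prepared route split
`WindowStep ⟸ CrystRegular ∧ NoDegenerateEdge` along the proved structure of
`ε = weilGroundEnergy` (continuous `continuousAt_weilGroundEnergy`, strictly antitone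
`weilGroundEnergy_lt_of_lt`, ground states exist `ConnesConsaniMoscovici2025_thm_3_6_holds`,
`ε > 0` below `log 3 / 2` from the kernel certificate `weilPositivityOn_log_three_half`):

* `windowStep_of_dichotomy` — child 1 (`CrystRegular`: every level `B ≥ log 2` whose half level is
  regular, `0 < ε(B/2)`, is a rung, from the seed) and child 2 (`NoDegenerateEdge`, closed form: for
  `a ≥ log 3 / 2`, if every level below `2a` is a rung then `0 < ε(a)`) give the crux (IVT);
* `windowStep_iff_dichotomy` — the split is EXACT (both children are crux-implied, via Collapse);
* `noDegenerateEdge_of_coagulationDense` — with the landed RH-free stubs of the line (trace levels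
  closed under suprema: `stub_traceLimit` + `stub_traceDilate`; ground-state sampling
  `stub_groundStateSampling`; little-o coagulation `coagulation_excluded_of_mult_le_log`) child 2
  REDUCES to its typed residual `CoagulationDense`: at a conjugate point `a ≥ log 3 / 2` no level-`2a`
  family with multiplicities of positive upper logarithmic density lies in the real zero set of a
  ground-state transform;
* `traceClosed` — the RH-free closedness of trace levels, stated once by name;
* `riemannHypothesis_of_dichotomy` — honest accounting: the two children + seed give RH.

All statements are spelled out binder-for-binder (no local `def`), so that the planner can file the
children verbatim and `--glue-by` `windowStep_of_dichotomy`.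
-/

set_option linter.dupNamespace false

noncomputable section

open Complex Set Filter
open scoped Topology

namespace Summit.RiemannHypothesis.RiemannHypothesis.Theorems.SpectralTraceWindowStep

open Literature.NumberTheory.LFunctions
open Summit.RiemannHypothesis.RiemannHypothesis.Theses.SpectralTrace
open Summit.RiemannHypothesis.RiemannHypothesis.Theorems
open Summit.RiemannHypothesis.RiemannHypothesis.Theorems.WindowStep.Negative
open Summit.RiemannHypothesis.RiemannHypothesis.Theorems.WeilWindowFlowGronwallLeakage

/-- `Trace(A)` (file-local notation, verbatim the shape of `WindowTraceArch` / `WindowStep`). -/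
local notation3 "WTrace " A:max => ∃ (ι : Type) (γ : ι → ℝ), ∀ g : ℝ → ℂ, IsWeilTest g →
  tsupport g ⊆ Set.Icc (-A) A →
    HasSum (fun i => weilMellin g (1 / 2 + (γ i : ℂ) * I)) (weilFunctional g)

/-! ## RH-free facts of the line, by name -/

/-- **Trace levels are closed under suprema (RH-free).** If every level `B ∈ (0, A)` carries a real
unit-multiplicity family reproducing `W` on the Weil tests of `[-B, B]`, so does `A`
(`stub_traceLimit`: one family for all `B < A`; `stub_traceDilate`: it serves the closed level).
[folklore] -/
theorem traceClosed :
    ∀ A : ℝ, 0 < A →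
      (∀ B : ℝ, 0 < B → B < A →
        ∃ (ι : Type) (γ : ι → ℝ), ∀ g : ℝ → ℂ, Literature.NumberTheory.LFunctions.IsWeilTest g →
          tsupport g ⊆ Set.Icc (-B) B →
            HasSum (fun i => Literature.NumberTheory.LFunctions.weilMellin g (1 / 2 + (γ i : ℂ) * Complex.I))
              (Literature.NumberTheory.LFunctions.weilFunctional g)) →
      ∃ (ι : Type) (γ : ι → ℝ), ∀ g : ℝ → ℂ, Literature.NumberTheory.LFunctions.IsWeilTest g →
        tsupport g ⊆ Set.Icc (-A) A →
          HasSum (fun i => Literature.NumberTheory.LFunctions.weilMellin g (1 / 2 + (γ i : ℂ) * Complex.I))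
            (Literature.NumberTheory.LFunctions.weilFunctional g) := by
  intro A hA h
  obtain ⟨ι, γ, hγ⟩ := stub_traceLimit A hA h
  exact ⟨ι, γ, stub_traceDilate A hA ι γ hγ⟩

/-- Below Yoshida's certified rung there is no conjugate point: `0 < ε(a)` for `0 < a < log 3 / 2`.
[folklore] -/
theorem weilGroundEnergy_pos_of_lt_log_three_half' {a : ℝ} (ha : 0 < a) (h : a < Real.log 3 / 2) :
    0 < weilGroundEnergy a :=
  weilGroundEnergy_pos_of_weilPositivityOn_of_lt weilPositivityOn_log_three_half ha h

/-- A level-`2a` family gives `0 ≤ ε(a)` (Bochner positivity on the half window). [folklore] -/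
theorem weilGroundEnergy_nonneg_of_wtrace' {a : ℝ} (ha : 0 < a) (h : WTrace (2 * a)) :
    0 ≤ weilGroundEnergy a := by
  have hpos : WeilPositivityOn (2 * a / 2) := windowTraceToPositivity_proof (2 * a) h
  rw [show 2 * a / 2 = a by ring] at hpos
  exact (weilGroundEnergy_nonneg_iff_holds ha).2 hpos

/-- **At a conjugate point every atom of a level-`2a` family is a real zero of every ground-state
transform** (`stub_groundStateSampling`: `Σ_i ‖û(1/2+iγ_i)‖² ≤ ε(a) = 0`). RH-free. [folklore] -/
theorem weilMellin_groundState_eq_zero_of_conjugate {a : ℝ} (ha : 0 < a)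
    (h0 : weilGroundEnergy a = 0) {ι : Type} {γ : ι → ℝ}
    (hγ : ∀ g : ℝ → ℂ, IsWeilTest g → tsupport g ⊆ Set.Icc (-(2 * a)) (2 * a) →
      HasSum (fun i => weilMellin g (1 / 2 + (γ i : ℂ) * I)) (weilFunctional g))
    {u : ℝ → ℂ} (hu : IsWeilGroundState a u) (i : ι) :
    weilMellin u (1 / 2 + (γ i : ℂ) * I) = 0 := by
  obtain ⟨hsum, hle⟩ := stub_groundStateSampling a ha ι γ hγ u hu
  rw [h0] at hle
  have hnn : ∀ j, 0 ≤ ‖weilMellin u (1 / 2 + (γ j : ℂ) * I)‖ ^ 2 := fun j => by positivity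
  have hi_le : ‖weilMellin u (1 / 2 + (γ i : ℂ) * I)‖ ^ 2 ≤
      ∑' j, ‖weilMellin u (1 / 2 + (γ j : ℂ) * I)‖ ^ 2 :=
    hsum.le_tsum i (fun j _ => hnn j)
  have hsq : ‖weilMellin u (1 / 2 + (γ i : ℂ) * I)‖ ^ 2 = 0 :=
    le_antisymm (hi_le.trans hle) (hnn i)
  exact norm_eq_zero.1 (sq_eq_zero_iff.1 hsq)

/-! ## Child 2 reduces to the dense-coagulation residual -/

/-- **Child 2 of the split (`NoDegenerateEdge`, closed form) from the dense-coagulation residual.**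
If, at every conjugate point `a ≥ log 3 / 2`, no level-`2a` family whose multiplicities have positive
upper logarithmic density lies in the real zero set of a ground-state transform, then for every
`a ≥ log 3 / 2`: if all levels below `2a` are rungs, `0 < ε(a)`. Proof: `traceClosed` puts a rung AT
`2a`; `ε(a) ≥ 0` by positivity; if `ε(a) = 0`, a ground state exists
(`ConnesConsaniMoscovici2025_thm_3_6_holds`), all atoms are zeros of its transform
(`weilMellin_groundState_eq_zero_of_conjugate`), and with `δ = δ(a)` of the landed
`coagulation_excluded_of_mult_le_log` the multiplicities are either `≤ δ log|x|` eventually (that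
lemma) or of upper density `≥ δ` (the hypothesis) — contradiction either way. [folklore] -/
theorem noDegenerateEdge_of_coagulationDense
    (hX : ∀ a : ℝ, Real.log 3 / 2 ≤ a → Literature.NumberTheory.LFunctions.weilGroundEnergy a = 0 →
      ∀ u : ℝ → ℂ, Literature.NumberTheory.LFunctions.IsWeilGroundState a u →
        ∀ (ι : Type) (γ : ι → ℝ) (δ : ℝ), 0 < δ →
          (∀ X : ℝ, ∃ x : ℝ, X ≤ |x| ∧ δ * Real.log |x| < ({i : ι | γ i = x}.ncard : ℝ)) →
          (∀ g : ℝ → ℂ, Literature.NumberTheory.LFunctions.IsWeilTest g →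
            tsupport g ⊆ Set.Icc (-(2 * a)) (2 * a) →
              HasSum (fun i => Literature.NumberTheory.LFunctions.weilMellin g (1 / 2 + (γ i : ℂ) * Complex.I))
                (Literature.NumberTheory.LFunctions.weilFunctional g)) →
          ∃ i : ι, Literature.NumberTheory.LFunctions.weilMellin u (1 / 2 + (γ i : ℂ) * Complex.I) ≠ 0) :
    ∀ a : ℝ, Real.log 3 / 2 ≤ a →
      (∀ B : ℝ, 0 < B → B < 2 * a →
        ∃ (ι : Type) (γ : ι → ℝ), ∀ g : ℝ → ℂ, Literature.NumberTheory.LFunctions.IsWeilTest g →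
          tsupport g ⊆ Set.Icc (-B) B →
            HasSum (fun i => Literature.NumberTheory.LFunctions.weilMellin g (1 / 2 + (γ i : ℂ) * Complex.I))
              (Literature.NumberTheory.LFunctions.weilFunctional g)) →
      0 < Literature.NumberTheory.LFunctions.weilGroundEnergy a := by
  intro a ha hbelow
  have hapos : 0 < a := lt_of_lt_of_le (by positivity) ha
  have hr : WTrace (2 * a) := traceClosed (2 * a) (by positivity) hbelow
  have h0le : 0 ≤ weilGroundEnergy a := weilGroundEnergy_nonneg_of_wtrace' hapos hr
  rcases h0le.lt_or_eq with hpos | h0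
  · exact hpos
  · exfalso
    have h0' : weilGroundEnergy a = 0 := h0.symm
    obtain ⟨u, hu⟩ :=
      ConnesConsaniMoscovici2025_thm_3_6_holds.exists_isWeilGroundState (a := a) hapos
    obtain ⟨ι, γ, hγ⟩ := hr
    have hvan : ∀ i : ι, weilMellin u (1 / 2 + (γ i : ℂ) * I) = 0 :=
      fun i => weilMellin_groundState_eq_zero_of_conjugate hapos h0' hγ hu i
    obtain ⟨δ, hδ, hlittle⟩ := coagulation_excluded_of_mult_le_log a hapos
    by_cases hsub : ∃ X : ℝ, ∀ x : ℝ, X ≤ |x| → ({i : ι | γ i = x}.ncard : ℝ) ≤ δ * Real.log |x|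
    · obtain ⟨i, hi⟩ := hlittle u hu ι γ hsub hγ
      exact hi (hvan i)
    · push Not at hsub
      obtain ⟨i, hi⟩ := hX a ha h0' u hu ι γ δ hδ hsub hγ
      exact hi (hvan i)

/-! ## The glue: child 1 ∧ child 2 ⇒ the crux -/

/-- **The conjugate-point dichotomy closes the crux (route-split glue).** From child 1
(`CrystRegular`: from the seed `WindowTraceArch`, every level `B ≥ log 2` with `0 < ε(B/2)` is a rung)
and child 2 (`NoDegenerateEdge`, closed form: for `a ≥ log 3 / 2`, if every level below `2a` is a
rung then `0 < ε(a)`), the step `Trace(log n) → Trace(log(n+1))` holds for every `n ≥ 2`. Proof: the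
rung gives the seed (antitonicity); if `ε(log(n+1)/2) > 0`, child 1; otherwise the rung's own half
level is regular (`n = 2`: certificate below `log 3 / 2`; `n ≥ 3`: child 2, all lower levels being
rungs by antitonicity), the IVT on the proved continuous `ε` yields a conjugate point
`c ∈ [log n / 2, log(n+1) / 2]`, every level `< 2c` is a rung (child 1 + strict antitonicity, or
antitonicity below `log 2`), `c ≥ log 3 / 2` (no conjugate point below), and child 2 at `c` gives
`0 < ε(c) = 0`. [folklore] -/
theorem windowStep_of_dichotomy :
    (∀ B : ℝ, Real.log 2 ≤ B →
      Summit.RiemannHypothesis.RiemannHypothesis.Theses.SpectralTrace.WindowTraceArch →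
        0 < Literature.NumberTheory.LFunctions.weilGroundEnergy (B / 2) →
          ∃ (ι : Type) (γ : ι → ℝ), ∀ g : ℝ → ℂ, Literature.NumberTheory.LFunctions.IsWeilTest g →
            tsupport g ⊆ Set.Icc (-B) B →
              HasSum (fun i => Literature.NumberTheory.LFunctions.weilMellin g (1 / 2 + (γ i : ℂ) * Complex.I))
                (Literature.NumberTheory.LFunctions.weilFunctional g)) →
    (∀ a : ℝ, Real.log 3 / 2 ≤ a →
      (∀ B : ℝ, 0 < B → B < 2 * a →
        ∃ (ι : Type) (γ : ι → ℝ), ∀ g : ℝ → ℂ, Literature.NumberTheory.LFunctions.IsWeilTest g →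
          tsupport g ⊆ Set.Icc (-B) B →
            HasSum (fun i => Literature.NumberTheory.LFunctions.weilMellin g (1 / 2 + (γ i : ℂ) * Complex.I))
              (Literature.NumberTheory.LFunctions.weilFunctional g)) →
      0 < Literature.NumberTheory.LFunctions.weilGroundEnergy a) →
    Summit.RiemannHypothesis.RiemannHypothesis.Theses.SpectralTrace.WindowStep := by
  intro hR hE n hn hrung
  have hn' : (2 : ℝ) ≤ n := by exact_mod_cast hn
  have hlog2 : 0 < Real.log 2 := Real.log_pos one_lt_two
  have hA₀ : 0 < Real.log (n : ℝ) := Real.log_pos (by linarith)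
  have h2n : Real.log 2 ≤ Real.log (n : ℝ) := Real.log_le_log two_pos hn'
  have hB : Real.log (n : ℝ) ≤ Real.log ((n : ℝ) + 1) :=
    Real.log_le_log (by linarith) (by linarith)
  -- the seed, from the rung (antitonicity)
  have hArch : WindowTraceArch := seed_of_rung hn hrung
  -- regularity of a half level `a` all of whose lower levels `< 2a` are rungs
  have hreg : ∀ a : ℝ, 0 < a → (∀ B' : ℝ, 0 < B' → B' < 2 * a → WTrace B') →
      0 < weilGroundEnergy a := by
    intro a ha hbelow
    by_cases hlt : a < Real.log 3 / 2
    · exact weilGroundEnergy_pos_of_lt_log_three_half' ha hlt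
    · exact hE a (le_of_not_gt hlt) hbelow
  by_cases hpos : 0 < weilGroundEnergy (Real.log ((n : ℝ) + 1) / 2)
  · exact hR _ (h2n.trans hB) hArch hpos
  · exfalso
    have hposle : weilGroundEnergy (Real.log ((n : ℝ) + 1) / 2) ≤ 0 := le_of_not_gt hpos
    -- the rung certifies regularity at its own half level
    have h0 : 0 < weilGroundEnergy (Real.log (n : ℝ) / 2) := by
      refine hreg _ (by positivity) fun B' _ hB'lt => ?_
      have hle : B' ≤ Real.log (n : ℝ) := by linarith
      exact windowTrace_anti hle hrung
    -- a conjugate point between the two half levels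
    have hle : Real.log (n : ℝ) / 2 ≤ Real.log ((n : ℝ) + 1) / 2 := by linarith
    have hcont : ContinuousOn weilGroundEnergy
        (Icc (Real.log (n : ℝ) / 2) (Real.log ((n : ℝ) + 1) / 2)) := fun x hx =>
      (continuousAt_weilGroundEnergy (lt_of_lt_of_le (by positivity) hx.1)).continuousWithinAt
    obtain ⟨c, hc, hc0⟩ : ∃ c ∈ Icc (Real.log (n : ℝ) / 2) (Real.log ((n : ℝ) + 1) / 2),
        weilGroundEnergy c = 0 :=
      intermediate_value_Icc' hle hcont ⟨hposle, h0.le⟩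
    have hcpos : 0 < c := lt_of_lt_of_le (by positivity) hc.1
    -- every level below `2c` is a rung
    have hbelow : ∀ B' : ℝ, 0 < B' → B' < 2 * c → WTrace B' := by
      intro B' hB'pos hB'lt
      by_cases hcase : Real.log 2 ≤ B'
      · have hreg' : 0 < weilGroundEnergy (B' / 2) := by
          have hlt : B' / 2 < c := by linarith
          have := weilGroundEnergy_lt_of_lt (a := B' / 2) (A := c) (by positivity) hlt
          linarith
        exact hR B' hcase hArch hreg'
      · exact windowTrace_anti (le_of_not_ge hcase) hArch
    -- the edge statement at `c`: `0 < ε(c) = 0`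
    have := hreg c hcpos hbelow
    linarith

/-! ## Exactness of the split and honest accounting -/

/-- Child 1 is crux-implied: under `WindowStep` the seed gives RH (Collapse), hence every level.
[folklore] -/
theorem crystRegular_of_windowStep'
    (hStep : Summit.RiemannHypothesis.RiemannHypothesis.Theses.SpectralTrace.WindowStep) :
    ∀ B : ℝ, Real.log 2 ≤ B →
      Summit.RiemannHypothesis.RiemannHypothesis.Theses.SpectralTrace.WindowTraceArch →
        0 < Literature.NumberTheory.LFunctions.weilGroundEnergy (B / 2) →
          ∃ (ι : Type) (γ : ι → ℝ), ∀ g : ℝ → ℂ, Literature.NumberTheory.LFunctions.IsWeilTest g →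
            tsupport g ⊆ Set.Icc (-B) B →
              HasSum (fun i => Literature.NumberTheory.LFunctions.weilMellin g (1 / 2 + (γ i : ℂ) * Complex.I))
                (Literature.NumberTheory.LFunctions.weilFunctional g) :=
  fun B _ hArch _ =>
    windowTrace_of_riemannHypothesis (riemannHypothesis_of_windowTraceArch_of_windowStep hArch hStep) B

/-- Child 2 is crux-implied: all levels below `2a ≥ log 3 > log 2` being rungs contains the seed, so
under `WindowStep` RH holds, Weil positivity holds at `a + 1`, and `ε(a) > 0` by strict antitonicity.
[folklore] -/
theorem noDegenerateEdge_of_windowStep'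
    (hStep : Summit.RiemannHypothesis.RiemannHypothesis.Theses.SpectralTrace.WindowStep) :
    ∀ a : ℝ, Real.log 3 / 2 ≤ a →
      (∀ B : ℝ, 0 < B → B < 2 * a →
        ∃ (ι : Type) (γ : ι → ℝ), ∀ g : ℝ → ℂ, Literature.NumberTheory.LFunctions.IsWeilTest g →
          tsupport g ⊆ Set.Icc (-B) B →
            HasSum (fun i => Literature.NumberTheory.LFunctions.weilMellin g (1 / 2 + (γ i : ℂ) * Complex.I))
              (Literature.NumberTheory.LFunctions.weilFunctional g)) →
      0 < Literature.NumberTheory.LFunctions.weilGroundEnergy a := by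
  intro a ha hbelow
  have hlog2 : 0 < Real.log 2 := Real.log_pos one_lt_two
  have hlog3 : Real.log 2 < Real.log 3 := Real.log_lt_log two_pos (by norm_num)
  have hArch : WindowTraceArch := hbelow (Real.log 2) hlog2 (by linarith)
  have hRH := riemannHypothesis_of_windowTraceArch_of_windowStep hArch hStep
  have hapos : 0 < a := lt_of_lt_of_le (by positivity) ha
  have hpos : WeilPositivityOn (a + 1) :=
    WeilPositivityOn.of_riemannHypothesis explicit_formula_holds hRH (a + 1)
  exact weilGroundEnergy_pos_of_weilPositivityOn_of_lt hpos hapos (by linarith)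

/-- **The split is exact**: `WindowStep ↔ (CrystRegular ∧ NoDegenerateEdge)`. [folklore] -/
theorem windowStep_iff_dichotomy :
    Summit.RiemannHypothesis.RiemannHypothesis.Theses.SpectralTrace.WindowStep ↔
      ((∀ B : ℝ, Real.log 2 ≤ B →
          Summit.RiemannHypothesis.RiemannHypothesis.Theses.SpectralTrace.WindowTraceArch →
            0 < Literature.NumberTheory.LFunctions.weilGroundEnergy (B / 2) →
              ∃ (ι : Type) (γ : ι → ℝ), ∀ g : ℝ → ℂ, Literature.NumberTheory.LFunctions.IsWeilTest g →
                tsupport g ⊆ Set.Icc (-B) B →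
                  HasSum (fun i => Literature.NumberTheory.LFunctions.weilMellin g (1 / 2 + (γ i : ℂ) * Complex.I))
                    (Literature.NumberTheory.LFunctions.weilFunctional g)) ∧
        (∀ a : ℝ, Real.log 3 / 2 ≤ a →
          (∀ B : ℝ, 0 < B → B < 2 * a →
            ∃ (ι : Type) (γ : ι → ℝ), ∀ g : ℝ → ℂ, Literature.NumberTheory.LFunctions.IsWeilTest g →
              tsupport g ⊆ Set.Icc (-B) B →
                HasSum (fun i => Literature.NumberTheory.LFunctions.weilMellin g (1 / 2 + (γ i : ℂ) * Complex.I))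
                  (Literature.NumberTheory.LFunctions.weilFunctional g)) →
          0 < Literature.NumberTheory.LFunctions.weilGroundEnergy a)) :=
  ⟨fun h => ⟨crystRegular_of_windowStep' h, noDegenerateEdge_of_windowStep' h⟩,
    fun h => windowStep_of_dichotomy h.1 h.2⟩

/-- **Honest accounting (Collapse made exact for the split).** The two children turn the SEED into
RH: `CrystRegular → NoDegenerateEdge → WindowTraceArch → RiemannHypothesis`. So the pair is jointly
worth `WindowTraceArch → RH`; by the threshold analysis of the line (interior death `A‡ < 2a⋆` vs
edge death `A‡ = 2a⋆` in a hypothetical `WindowTraceArch ∧ ¬RH` world) neither child alone is.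
[folklore] -/
theorem riemannHypothesis_of_dichotomy
    (hR : ∀ B : ℝ, Real.log 2 ≤ B →
      Summit.RiemannHypothesis.RiemannHypothesis.Theses.SpectralTrace.WindowTraceArch →
        0 < Literature.NumberTheory.LFunctions.weilGroundEnergy (B / 2) →
          ∃ (ι : Type) (γ : ι → ℝ), ∀ g : ℝ → ℂ, Literature.NumberTheory.LFunctions.IsWeilTest g →
            tsupport g ⊆ Set.Icc (-B) B →
              HasSum (fun i => Literature.NumberTheory.LFunctions.weilMellin g (1 / 2 + (γ i : ℂ) * Complex.I))
                (Literature.NumberTheory.LFunctions.weilFunctional g))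
    (hE : ∀ a : ℝ, Real.log 3 / 2 ≤ a →
      (∀ B : ℝ, 0 < B → B < 2 * a →
        ∃ (ι : Type) (γ : ι → ℝ), ∀ g : ℝ → ℂ, Literature.NumberTheory.LFunctions.IsWeilTest g →
          tsupport g ⊆ Set.Icc (-B) B →
            HasSum (fun i => Literature.NumberTheory.LFunctions.weilMellin g (1 / 2 + (γ i : ℂ) * Complex.I))
              (Literature.NumberTheory.LFunctions.weilFunctional g)) →
      0 < Literature.NumberTheory.LFunctions.weilGroundEnergy a)
    (hArch : Summit.RiemannHypothesis.RiemannHypothesis.Theses.SpectralTrace.WindowTraceArch) :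
    _root_.RiemannHypothesis :=
  riemannHypothesis_of_windowTraceArch_of_windowStep hArch (windowStep_of_dichotomy hR hE)

end Summit.RiemannHypothesis.RiemannHypothesis.Theorems.SpectralTraceWindowStep

end
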